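import Summits.CriticalPhenomena.PercolationContinuityZ3.Theorems.SahiBoxTP2TiltSpins
import Summits.CriticalPhenomena.PercolationContinuityZ3.Theorems.SahiBoxTP2GibbsHilbertCountable
import Summits.CriticalPhenomena.PercolationContinuityZ3.Theorems.SahiBoxTP2TiltRealSeq
import Summits.CriticalPhenomena.PercolationContinuityZ3.Theorems.SahiIsingWeakLimits

/-!
# Ferromagnetic quasilocal specifications on `{−1,+1}^ι`: finite-volume Gibbs measures with any boundary condition
# and all their weak limits are box-TP₂

Support file of the Sahi cell (`prim-sahi`, typer seat, generation 14; `--supports stmt-CriticalPhenomena-4575`).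
Theorems only (no definitions, no named facts, no sorries).  The two-valued-spin analogue of
`SahiBoxTP2GibbsHilbert[Countable].lean` and the model-independent extension of generation 13's nearest-neighbour
Ising theorems (`SahiIsingBoxTP2.lean`): arbitrary continuous (= quasilocal, e.g. absolutely summable, any range,
many-body) submodular (= ferromagnetic) energies `H`, arbitrary one-site laws (fields / Dirac masses = boundary
conditions).

* `isBoxTP2_infinitePi_spinConfig_nat`, `isBoxTP2_infinitePi_spinConfig` — every product probability measure on
  `{−1,+1}^ℕ` / `{−1,+1}^ι` (`ι ≃ ℕ`) is box-TP₂ (marginals are finite products of chain laws).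
* `isBoxTP2_gibbs_spinConfig` — `e^{−H} · ⊗_x μ_x` is box-TP₂; `isBoxTP2_gibbs_spinConfig_bc` — one-site laws `ν_x`
  in `Λ`, spins frozen at `ω` outside.
* `isBoxTP2_of_tendsto_gibbs_spinConfig` — every weak limit (any filter) of normalised such Gibbs measures, with
  volumes, boundary conditions and interactions varying, is box-TP₂; consequences
  `integral_mul_integral_le_of_tendsto_gibbs_spinConfig` (FKG for all measurable monotone functionals),
  `msahiE_nonneg_of_tendsto_gibbs_spinConfig_of_sahiConjecture` (Sahi positivity of every order given `C_n`),
  `msahiE_threeSites_nonneg_of_tendsto_gibbs_spinConfig` (unconditional, three spins, every order).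

No sorries, no new axioms.
-/

noncomputable section

namespace Summit.CriticalPhenomena.PercolationContinuityZ3.Theorems.SahiBoxTP2

open MeasureTheory Set Filter Topology Function Literature.Combinatorics.Sahi2008
open Literature.Probability.LatticeModels
open scoped ENNReal NNReal

/-! ### Product measures on `{−1,+1}^ℕ` and `{−1,+1}^ι` -/

/-- **Every product probability measure on `{−1,+1}^ℕ` is box-TP₂.** [this work] -/
theorem isBoxTP2_infinitePi_spinConfig_nat (μ : ℕ → Measure ℤˣ) [∀ i, IsProbabilityMeasure (μ i)] :
    IsBoxTP2 (Measure.infinitePi μ) := by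
  haveI : OrderClosedTopology ℤˣ := ⟨isClosed_discrete _⟩
  refine isBoxTP2_of_eventually_map_finRestrict' (fun d a b => (Set.toFinite _).measurableSet)
    (Eventually.of_forall fun d => ?_)
  rw [infinitePi_map_finRestrict_family μ d]
  exact IsBoxTP2.pi fun i : Fin d => μ i

/-- **Every product probability measure on `{−1,+1}^ι` (`ι ≃ ℕ`) is box-TP₂.** [this work] -/
theorem isBoxTP2_infinitePi_spinConfig {ι : Type*} (e : ι ≃ ℕ) (μ : ι → Measure ℤˣ)
    [∀ i, IsProbabilityMeasure (μ i)] : IsBoxTP2 (Measure.infinitePi μ) := by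
  rw [← Measure.infinitePi_map_piCongrLeft μ e.symm, coe_piCongrLeft_symm_eq_reindex e]
  exact (isBoxTP2_infinitePi_spinConfig_nat fun k => μ (e.symm k)).map_orderIso (reindex e)
    (measurableEmbedding_reindex e)

/-! ### Gibbs measures -/

section Gibbs

variable {ι : Type*}

/-- **Finite-volume Gibbs measures of ferromagnetic quasilocal specifications on `{−1,+1}^ι` are box-TP₂, for
every boundary condition**: `e^{−H} · ⊗_x μ_x` with `H` continuous and submodular
(`H (σ ⊓ τ) + H (σ ⊔ τ) ≤ H σ + H τ`) and any one-site laws `μ_x`. [this work] -/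
theorem isBoxTP2_gibbs_spinConfig [Countable ι] (e : ι ≃ ℕ) (μ : ι → Measure ℤˣ) [∀ i, IsProbabilityMeasure (μ i)]
    {H : (ι → ℤˣ) → ℝ} (hHc : Continuous H) (hH : ∀ σ τ, H (σ ⊓ τ) + H (σ ⊔ τ) ≤ H σ + H τ) :
    IsBoxTP2 ((Measure.infinitePi μ).withDensity fun σ => ENNReal.ofReal (Real.exp (-H σ))) :=
  (isBoxTP2_infinitePi_spinConfig e μ).withDensity_exp_of_submodular_spinConfig e hHc hH

/-- The boundary-condition form: one-site laws `ν_x` inside `Λ`, spins frozen at `ω` outside. [this work] -/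
theorem isBoxTP2_gibbs_spinConfig_bc [Countable ι] [DecidableEq ι] (e : ι ≃ ℕ) (Λ : Finset ι) (ν : ι → Measure ℤˣ)
    [∀ i, IsProbabilityMeasure (ν i)] (ω : ι → ℤˣ) {H : (ι → ℤˣ) → ℝ} (hHc : Continuous H)
    (hH : ∀ σ τ, H (σ ⊓ τ) + H (σ ⊔ τ) ≤ H σ + H τ) :
    IsBoxTP2 ((Measure.infinitePi fun i => if i ∈ Λ then ν i else Measure.dirac (ω i)).withDensity
      fun σ => ENNReal.ofReal (Real.exp (-H σ))) := by
  haveI : ∀ i, IsProbabilityMeasure (if i ∈ Λ then ν i else Measure.dirac (ω i)) := fun i => by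
    split_ifs <;> infer_instance
  exact isBoxTP2_gibbs_spinConfig e _ hHc hH

variable [Countable ι] (e : ι ≃ ℕ) {κ : Type*} {L : Filter κ} [NeBot L]
include e

/-- **Every weak limit of finite-volume Gibbs measures of ferromagnetic quasilocal specifications on `{−1,+1}^ι` is
box-TP₂** — volumes, boundary conditions / one-site laws and continuous submodular interactions may vary along any
filter; `μs k` is the normalised Gibbs measure `Z_k⁻¹ e^{−H_k} ⊗_x μ^k_x`. [this work] -/
theorem isBoxTP2_of_tendsto_gibbs_spinConfig {μs : κ → ProbabilityMeasure (ι → ℤˣ)}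
    {μ : ProbabilityMeasure (ι → ℤˣ)} (hconv : Tendsto μs L (𝓝 μ))
    (hμs : ∀ k, ∃ (c : ℝ≥0∞) (P : ι → Measure ℤˣ) (_ : ∀ i, IsProbabilityMeasure (P i)) (H : (ι → ℤˣ) → ℝ),
      Continuous H ∧ (∀ σ τ, H (σ ⊓ τ) + H (σ ⊔ τ) ≤ H σ + H τ) ∧
        (μs k : Measure (ι → ℤˣ)) = c • (Measure.infinitePi P).withDensity fun σ => ENNReal.ofReal (Real.exp (-H σ))) :
    IsBoxTP2 (μ : Measure (ι → ℤˣ)) := by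
  refine isBoxTP2_of_tendsto_probabilityMeasure_spinConfig hconv (Eventually.of_forall fun k => ?_)
  obtain ⟨c, P, hP, H, hHc, hH, hk⟩ := hμs k
  rw [hk]
  exact (isBoxTP2_gibbs_spinConfig e P hHc hH).smul c

variable [Infinite ι]

/-- **FKG for weak limits of ferromagnetic quasilocal Gibbs measures on `{−1,+1}^ι`**, all measurable nonnegative
monotone functionals. [this work] -/
theorem integral_mul_integral_le_of_tendsto_gibbs_spinConfig {μs : κ → ProbabilityMeasure (ι → ℤˣ)}
    {μ : ProbabilityMeasure (ι → ℤˣ)} (hconv : Tendsto μs L (𝓝 μ))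
    (hμs : ∀ k, ∃ (c : ℝ≥0∞) (P : ι → Measure ℤˣ) (_ : ∀ i, IsProbabilityMeasure (P i)) (H : (ι → ℤˣ) → ℝ),
      Continuous H ∧ (∀ σ τ, H (σ ⊓ τ) + H (σ ⊔ τ) ≤ H σ + H τ) ∧
        (μs k : Measure (ι → ℤˣ)) = c • (Measure.infinitePi P).withDensity fun σ => ENNReal.ofReal (Real.exp (-H σ)))
    {f g : (ι → ℤˣ) → ℝ} (hfm : Measurable f) (hgm : Measurable g) (hf0 : ∀ σ, 0 ≤ f σ) (hg0 : ∀ σ, 0 ≤ g σ)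
    (hf : Monotone f) (hg : Monotone g) :
    (∫ σ, f σ ∂(μ : Measure (ι → ℤˣ))) * (∫ σ, g σ ∂(μ : Measure (ι → ℤˣ))) ≤
      ∫ σ, f σ * g σ ∂(μ : Measure (ι → ℤˣ)) :=
  integral_mul_integral_le_of_isBoxTP2_spinConfig (μ : Measure (ι → ℤˣ))
    (isBoxTP2_of_tendsto_gibbs_spinConfig e hconv hμs) hfm hgm hf0 hg0 hf hg

/-- **Sahi positivity of every order, given `C_n`, for weak limits of ferromagnetic quasilocal Gibbs measures on
`{−1,+1}^ι`.** [this work; conditional on Sahi's conjecture `C_n`] -/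
theorem msahiE_nonneg_of_tendsto_gibbs_spinConfig_of_sahiConjecture {n : ℕ} (hC : SahiConjecture n)
    {μs : κ → ProbabilityMeasure (ι → ℤˣ)} {μ : ProbabilityMeasure (ι → ℤˣ)} (hconv : Tendsto μs L (𝓝 μ))
    (hμs : ∀ k, ∃ (c : ℝ≥0∞) (P : ι → Measure ℤˣ) (_ : ∀ i, IsProbabilityMeasure (P i)) (H : (ι → ℤˣ) → ℝ),
      Continuous H ∧ (∀ σ τ, H (σ ⊓ τ) + H (σ ⊔ τ) ≤ H σ + H τ) ∧
        (μs k : Measure (ι → ℤˣ)) = c • (Measure.infinitePi P).withDensity fun σ => ENNReal.ofReal (Real.exp (-H σ)))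
    (f : Fin n → (ι → ℤˣ) → ℝ) (hfm : ∀ i, Measurable (f i)) (hf0 : ∀ i σ, 0 ≤ f i σ)
    (hmono : ∀ i, Monotone (f i)) : 0 ≤ msahiE (μ : Measure (ι → ℤˣ)) n f :=
  msahiE_nonneg_of_isBoxTP2_spinConfig_of_sahiConjecture hC (μ : Measure (ι → ℤˣ))
    (isBoxTP2_of_tendsto_gibbs_spinConfig e hconv hμs) f hfm hf0 hmono

omit [Infinite ι] in
/-- **Unconditionally: positivity of every order for functions of three spins under weak limits of ferromagnetic
quasilocal Gibbs measures.** [this work] -/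
theorem msahiE_threeSites_nonneg_of_tendsto_gibbs_spinConfig [DecidableEq ι] {μs : κ → ProbabilityMeasure (ι → ℤˣ)}
    {μ : ProbabilityMeasure (ι → ℤˣ)} (hconv : Tendsto μs L (𝓝 μ))
    (hμs : ∀ k, ∃ (c : ℝ≥0∞) (P : ι → Measure ℤˣ) (_ : ∀ i, IsProbabilityMeasure (P i)) (H : (ι → ℤˣ) → ℝ),
      Continuous H ∧ (∀ σ τ, H (σ ⊓ τ) + H (σ ⊔ τ) ≤ H σ + H τ) ∧
        (μs k : Measure (ι → ℤˣ)) = c • (Measure.infinitePi P).withDensity fun σ => ENNReal.ofReal (Real.exp (-H σ)))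
    {n : ℕ} (v : Fin 3 → ι) (g : Fin n → (Fin 3 → ℤˣ) → ℝ) (hg0 : ∀ i y, 0 ≤ g i y) (hmono : ∀ i, Monotone (g i)) :
    0 ≤ msahiE (μ : Measure (ι → ℤˣ)) n fun i σ => g i fun a => σ (v a) :=
  msahiE_threeSites_nonneg_of_isBoxTP2 (μ : Measure (ι → ℤˣ)) (isBoxTP2_of_tendsto_gibbs_spinConfig e hconv hμs)
    v g hg0 hmono

end Gibbs

end Summit.CriticalPhenomena.PercolationContinuityZ3.Theorems.SahiBoxTP2
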